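import Summits.QuantumFields.YangMills.Theorems.ColdStartUniversalityLatticeLangevinTranslationCovariance
import HarnessLib

/-!
# Route `ColdStartUniversality` (cruxes 27363 / 24810 / aside 24809): THE SZZ LATTICE LANGEVIN DYNAMICS COMMUTES WITH THE
# PERMUTATIONS OF THE LATTICE AXES — pathwise, in law, on the Markov semigroup; cold-start loop-string expectations are
# `S₃`-invariant

Helper file (seat `ym-line-csu-p1`, g14; `--supports stmt-QuantumFields-27363`).  Companion of
`…LatticeLangevinTranslationCovariance` (p721082): together, the orientation-preserving symmetry group
`(ℤ/L)³ ⋊ S₃` of the periodic box acts on link configurations by pure relabelling of the positively oriented links,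
`(U ∘ σ_π)(x, i) = U(πx, π i)` with `(πx)_ν = x_{π⁻¹ ν}`, and the SZZ system is covariant (the axis REFLECTIONS reverse link
orientations and are not treated here).

* §1 algebra (any `r`, `d`): `rootedLoop_permute` (the loop of `Q ∘ σ_π` through `e` in the plane `{e.2, j}` is the loop of
  `Q` through `σ_π e` in the plane `{π e.2, π j}`), `driftLie_permute` (re-indexing `j ↦ π j` of the sum over planes),
  `drift_permute`, `noise_permute`;
* §2 `relabel_permMatrix` (any relabelling equivalence of `Edge × κ` is an orthogonal permutation matrix acting on noise paths),
  `isFlatBrownian_permute`, `natFiltration_permute_eq`;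
* §3 ★ `isSolution_permute`; §4 ★ `map_permute_eq`, `markovTransition_permute`, ★★ `map_permute_coldStart` (the law of
  every cold-start solution is `S₃`-invariant at every `K, t`), `integral_permute_coldStart`;
* crux currency (loop strings, `avgObs_permute`) in the companion `…LatticeLangevinPermutationStrings`.

THEOREMS ONLY, [folklore]; RECORD-rung R3 plumbing; no crux, rung or summit statement is proved here and the Yang–Mills
mass gap is NOT proved.
-/

set_option autoImplicit false

noncomputable section

namespace Summit.QuantumFields.YangMills.Theorems.ColdStartUniversality.TranslationCovariance

open MeasureTheory ProbabilityTheory Filter Matrix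
open scoped NNReal ENNReal BigOperators
open Literature.Probability.Process Literature.MathematicalPhysics.QuantumFieldTheory
open Literature.MathematicalPhysics.QuantumLattice (fundamentalRep fundamentalLatticeRep continuous_fundamentalRep)

/-! ## §1 Algebra: the SDE data are covariant under axis permutations -/

section Algebra

variable {G : Type*} [Group G] [TopologicalSpace G] (r : LatticeRep G) {d L N : ℕ}

/-- `π(x + eᵢ) = πx + e_{π i}`. [folklore] -/
theorem permute_shift (π : Equiv.Perm (Fin d)) (x : Literature.MathematicalPhysics.QuantumFieldTheory.Site d L) (i : Fin d) :
    (fun ν => (x.shift i) (π.symm ν)) = Literature.MathematicalPhysics.QuantumFieldTheory.Site.shift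
      (fun ν => x (π.symm ν) : Literature.MathematicalPhysics.QuantumFieldTheory.Site d L) (π i) := by
  funext ν
  simp only [Literature.MathematicalPhysics.QuantumFieldTheory.Site.shift, Pi.add_apply]
  congr 1
  by_cases h : π.symm ν = i
  · rw [h, Pi.single_eq_same, show ν = π i by rw [← h, Equiv.apply_symm_apply], Pi.single_eq_same]
  · rw [Pi.single_eq_of_ne h, Pi.single_eq_of_ne]
    intro h'
    exact h (by rw [h', Equiv.symm_apply_apply])

/-- `π(x − eⱼ) = πx − e_{π j}`. [folklore] -/
theorem permute_sub_single (π : Equiv.Perm (Fin d)) (x : Literature.MathematicalPhysics.QuantumFieldTheory.Site d L) (j : Fin d) :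
    (fun ν => ((x - Pi.single j (1 : ZMod L) : Fin d → ZMod L)) (π.symm ν)) =
      (fun ν => x (π.symm ν) : Literature.MathematicalPhysics.QuantumFieldTheory.Site d L) - Pi.single (π j) (1 : ZMod L) := by
  funext ν
  simp only [Pi.sub_apply]
  congr 1
  by_cases h : π.symm ν = j
  · rw [h, Pi.single_eq_same, show ν = π j by rw [← h, Equiv.apply_symm_apply], Pi.single_eq_same]
  · rw [Pi.single_eq_of_ne h, Pi.single_eq_of_ne]
    intro h'
    exact h (by rw [h', Equiv.symm_apply_apply])

/-- **The rooted plaquette loops are covariant under axis permutations**: the loop of `Q ∘ σ_π` rooted at `e = (x, i)` in the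
plane `{i, j}` is the loop of `Q` rooted at `σ_π e = (πx, π i)` in the plane `{π i, π j}`. [cite: ShenZhuZhu2022, §3 (before Lemma 3.1)] -/
theorem rootedLoop_permute (Q : MatrixConfig d L N) (π : Equiv.Perm (Fin d)) (e : Edge d L) (j : Fin d) (b : Bool) :
    rootedLoop (fun e' : Edge d L => Q ((fun ν => e'.1 (π.symm ν)), π e'.2)) e j b =
      rootedLoop Q ((fun ν => e.1 (π.symm ν)), π e.2) (π j) b := by
  obtain ⟨x, i⟩ := e
  cases b with
  | false => simp only [rootedLoop, permute_shift]
  | true => simp only [rootedLoop, permute_shift, permute_sub_single]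

/-- **The Lie drift is covariant under axis permutations** (re-index the sum over planes `j ≠ i` by `j ↦ π j`).
[cite: ShenZhuZhu2022, §3 Lemma 3.1] -/
theorem driftLie_permute (β : ℝ) (Q : MatrixConfig d L r.N) (π : Equiv.Perm (Fin d)) (e : Edge d L) :
    r.driftLie β (fun e' : Edge d L => Q ((fun ν => e'.1 (π.symm ν)), π e'.2)) e =
      r.driftLie β Q ((fun ν => e.1 (π.symm ν)), π e.2) := by
  unfold LatticeRep.driftLie
  refine congrArg (fun M : Matrix (Fin r.N) (Fin r.N) ℂ => β • M) ?_
  refine Finset.sum_equiv π (fun j => ?_) (fun j _ => ?_)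
  · simp only [Finset.mem_erase, Finset.mem_univ, and_true]
    exact π.injective.ne_iff.symm
  · refine Finset.sum_congr rfl fun b _ => ?_
    rw [rootedLoop_permute Q π e j b]

/-- ★ **The SZZ drift is covariant under axis permutations**: `b_e(Q ∘ σ_π) = b_{σ_π e}(Q)`. [cite: ShenZhuZhu2022, §3 Lemma 3.1] -/
theorem drift_permute (β : ℝ) (Q : MatrixConfig d L r.N) (π : Equiv.Perm (Fin d)) (e : Edge d L) :
    (latticeLangevinDynamics r β).drift (fun e' : Edge d L => Q ((fun ν => e'.1 (π.symm ν)), π e'.2)) e =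
      (latticeLangevinDynamics r β).drift Q ((fun ν => e.1 (π.symm ν)), π e.2) := by
  simp only [latticeLangevinDynamics_drift]
  rw [driftLie_permute]

/-- ★ **The SZZ noise coefficients are covariant under axis permutations.** [cite: ShenZhuZhu2022, §3 (the SDE system after Lemma 3.1)] -/
theorem noise_permute (β : ℝ) (Q : MatrixConfig d L r.N) (π : Equiv.Perm (Fin d)) (e : Edge d L) (n : NoiseIdx r.N) :
    (latticeLangevinDynamics r β).noise (fun e' : Edge d L => Q ((fun ν => e'.1 (π.symm ν)), π e'.2)) e n =
      (latticeLangevinDynamics r β).noise Q ((fun ν => e.1 (π.symm ν)), π e.2) n := by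
  simp only [latticeLangevinDynamics_noise]

end Algebra

/-! ## §2 Relabelled drivers -/

section Noise

variable {d L : ℕ} [NeZero L] {κ : Type*} [Fintype κ] [DecidableEq κ] {Ω : Type*} {mΩ : MeasurableSpace Ω}
  {P : Measure Ω}

/-- **Any relabelling equivalence of the noise index set is an orthogonal permutation matrix acting on noise paths by the
relabelling.** [folklore] -/
theorem relabel_permMatrix (σ : Edge d L × κ ≃ Edge d L × κ) :
    ((Matrix.of fun i j : Edge d L × κ => if j = σ i then (1 : ℝ) else 0).transpose *
        (Matrix.of fun i j : Edge d L × κ => if j = σ i then (1 : ℝ) else 0) = 1) ∧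
    ∀ (W : ℝ≥0 → Ω → (Edge d L × κ → ℝ)),
      (fun t ω (i : Edge d L × κ) => ∑ j, (Matrix.of fun i j : Edge d L × κ => if j = σ i then (1 : ℝ) else 0) i j * W t ω j) =
      fun t ω p => W t ω (σ p) := by
  classical
  refine ⟨?_, fun W => ?_⟩
  · ext q q'
    simp only [Matrix.mul_apply, Matrix.transpose_apply, Matrix.of_apply]
    have hrew : ∀ p : Edge d L × κ, ((if q = σ p then (1 : ℝ) else 0) * (if q' = σ p then (1 : ℝ) else 0)) =
        if p = σ.symm q then (if q = q' then (1 : ℝ) else 0) else 0 := by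
      intro p
      by_cases hp : p = σ.symm q
      · have hq : q = σ p := by rw [hp, Equiv.apply_symm_apply]
        rw [if_pos hp, if_pos hq, one_mul, ← hq]
        by_cases hqq : q = q'
        · rw [if_pos hqq, if_pos hqq.symm]
        · rw [if_neg hqq, if_neg (Ne.symm hqq)]
      · have hq : q ≠ σ p := by
          intro h
          apply hp
          rw [h, Equiv.symm_apply_apply]
        rw [if_neg hq, zero_mul, if_neg hp]
    simp_rw [hrew]
    rw [Finset.sum_ite_eq' Finset.univ (σ.symm q), if_pos (Finset.mem_univ _), Matrix.one_apply]
  · funext t ω i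
    simp only [Matrix.of_apply]
    have hrew : ∀ j : Edge d L × κ, (if j = σ i then (1 : ℝ) else 0) * W t ω j = if j = σ i then W t ω j else 0 := fun j => by
      split_ifs <;> simp
    simp_rw [hrew]
    rw [Finset.sum_ite_eq' Finset.univ, if_pos (Finset.mem_univ _)]

omit [NeZero L] [Fintype κ] [DecidableEq κ] in
/-- The relabelling of `Edge × κ` induced by an axis permutation. [folklore] -/
theorem permEdgeEquiv_spec (π : Equiv.Perm (Fin d)) :
    ∃ σ : Edge d L × κ ≃ Edge d L × κ, ∀ p : Edge d L × κ, σ p = (((fun ν => p.1.1 (π.symm ν)), π p.1.2), p.2) := by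
  refine ⟨{ toFun := fun p => (((fun ν => p.1.1 (π.symm ν)), π p.1.2), p.2),
             invFun := fun p => (((fun ν => p.1.1 (π ν)), π.symm p.1.2), p.2),
             left_inv := fun p => ?_,
             right_inv := fun p => ?_ }, fun p => rfl⟩
  · obtain ⟨⟨x, i⟩, n⟩ := p
    simp only [Equiv.symm_apply_apply]
  · obtain ⟨⟨x, i⟩, n⟩ := p
    simp only [Equiv.apply_symm_apply]

/-- ★ **The relabelled driver `W'^{e,n} = W^{σ_π e, n}` is a flat Brownian noise.** [folklore] -/
theorem isFlatBrownian_permute {W : ℝ≥0 → Ω → (Edge d L × κ → ℝ)} (hW : IsFlatBrownian W P) (π : Equiv.Perm (Fin d)) :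
    IsFlatBrownian (fun t ω (p : Edge d L × κ) => W t ω (((fun ν => p.1.1 (π.symm ν)), π p.1.2), p.2)) P := by
  classical
  obtain ⟨σ, hσ⟩ := permEdgeEquiv_spec (L := L) (κ := κ) π
  obtain ⟨hR, hfun⟩ := relabel_permMatrix (Ω := Ω) σ
  have hW' : (fun t ω (p : Edge d L × κ) => W t ω (((fun ν => p.1.1 (π.symm ν)), π p.1.2), p.2)) =
      fun t ω p => W t ω (σ p) := by
    funext t ω p
    rw [hσ p]
  rw [hW', ← hfun W]
  exact NoiseRotation.isFlatBrownian_orthogonal hW _ hR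

/-- **… with the SAME raw natural filtration as `W`.** [folklore] -/
theorem natFiltration_permute_eq {W : ℝ≥0 → Ω → (Edge d L × κ → ℝ)} (hW : IsFlatBrownian W P) (π : Equiv.Perm (Fin d)) :
    (isFlatBrownian_permute hW π).natFiltration = hW.natFiltration := by
  classical
  obtain ⟨σ, hσ⟩ := permEdgeEquiv_spec (L := L) (κ := κ) π
  obtain ⟨hR, hfun⟩ := relabel_permMatrix (Ω := Ω) σ
  have hW' : (fun t ω (p : Edge d L × κ) => W t ω (((fun ν => p.1.1 (π.symm ν)), π p.1.2), p.2)) =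
      fun t ω p => W t ω (σ p) := by
    funext t ω p
    rw [hσ p]
  have key : ∀ (W₁ W₂ : ℝ≥0 → Ω → (Edge d L × κ → ℝ)) (h : W₁ = W₂) (h₁ : IsFlatBrownian W₁ P)
      (h₂ : IsFlatBrownian W₂ P), h₁.natFiltration = h₂.natFiltration := by
    intro W₁ W₂ h h₁ h₂
    subst h
    rfl
  rw [key _ _ (hW'.trans (hfun W).symm) (isFlatBrownian_permute hW π) (NoiseRotation.isFlatBrownian_orthogonal hW _ hR)]
  exact NoiseRotation.natFiltration_orthogonal_eq hW _ hR

end Noise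

/-! ## §3 The pathwise transfer -/

section Transfer

variable {L : ℕ} {Ω : Type*} {mΩ : MeasurableSpace Ω} {P : Measure Ω} {𝓕 : Filtration ℝ≥0 mΩ}
  {W : ℝ≥0 → Ω → (Edge 3 L × NoiseIdx 2 → ℝ)}

/-- `V ↦ V ∘ σ_π` is measurable (pure relabelling of coordinates). [folklore] -/
theorem measurable_compPermute {d : ℕ} {G : Type*} [MeasurableSpace G] (π : Equiv.Perm (Fin d)) :
    Measurable fun V : GaugeConfig d L G => fun e : Edge d L => V ((fun ν => e.1 (π.symm ν)), π e.2) :=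
  measurable_pi_lambda _ fun e => measurable_pi_apply ((fun ν => e.1 (π.symm ν)), π e.2)

/-- `V ↦ V ∘ σ_π` is continuous. [folklore] -/
theorem continuous_compPermute {d : ℕ} {G : Type*} [TopologicalSpace G] (π : Equiv.Perm (Fin d)) :
    Continuous fun V : GaugeConfig d L G => fun e : Edge d L => V ((fun ν => e.1 (π.symm ν)), π e.2) :=
  continuous_pi fun e => continuous_apply ((fun ν => e.1 (π.symm ν)), π e.2)

/-- ★★ **The SZZ dynamics commutes with axis permutations (pathwise).**  If `U` solves the `SU(2)` lattice Langevin system at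
coupling `β'` driven by `W` w.r.t. `𝓕`, then `t ↦ U_t ∘ σ_π` solves the SAME system driven by the relabelled noise
`W'^{e,n} = W^{σ_π e, n}` w.r.t. the same `𝓕`. [folklore] -/
theorem isSolution_permute (β' : ℝ) (π : Equiv.Perm (Fin 3))
    {U : ℝ≥0 → Ω → GaugeConfig 3 L (Matrix.specialUnitaryGroup (Fin 2) ℂ)}
    (hU : (latticeLangevinDynamics (fundamentalLatticeRep 2) β').IsSolution (fundamentalRep (Fin 2)) 𝓕 P W U) :
    (latticeLangevinDynamics (fundamentalLatticeRep 2) β').IsSolution (fundamentalRep (Fin 2)) 𝓕 P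
      (fun t ω (p : Edge 3 L × NoiseIdx 2) => W t ω (((fun ν => p.1.1 (π.symm ν)), π p.1.2), p.2))
      (fun t ω (e : Edge 3 L) => U t ω ((fun ν => e.1 (π.symm ν)), π e.2)) := by
  set r : LatticeRep (Matrix.specialUnitaryGroup (Fin 2) ℂ) := fundamentalLatticeRep 2 with hr
  have hQ : ∀ V : GaugeConfig 3 L (Matrix.specialUnitaryGroup (Fin 2) ℂ),
      matrixConfig r.ρ (fun e : Edge 3 L => V ((fun ν => e.1 (π.symm ν)), π e.2)) =
        fun e : Edge 3 L => matrixConfig r.ρ V ((fun ν => e.1 (π.symm ν)), π e.2) := fun V => rfl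
  obtain ⟨J, hJ, hae⟩ := hU.exists_ito
  have hJ' : ∀ (e : Edge 3 L) (n : NoiseIdx r.N) (i j : Fin r.N),
      IsItoIntegralC (fun t ω => (latticeLangevinDynamics r β').noise (matrixConfig r.ρ (U t ω)) e n i j)
        (fun t ω => W t ω (e, n)) (J e n i j) 𝓕 P := fun e n i j => hJ e n i j
  have hae' : ∀ᵐ ω ∂P, ∀ (t : ℝ≥0) (e : Edge 3 L) (i j : Fin r.N),
      r.ρ (U t ω e) i j = r.ρ (U 0 ω e) i j +
        (∫ s in (0 : ℝ)..t, (latticeLangevinDynamics r β').drift (matrixConfig r.ρ (U s.toNNReal ω)) e i j) +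
        ∑ n : NoiseIdx r.N, J e n i j t ω := hae
  refine ⟨fun t => (measurable_compPermute π).comp (hU.adapted t), ?_, ?_⟩
  · filter_upwards [hU.continuous] with ω hω using (continuous_compPermute π).comp hω
  · refine ⟨fun e n i j t ω => J ((fun ν => e.1 (π.symm ν)), π e.2) n i j t ω, fun e n i j => ?_, ?_⟩
    · have goal : IsItoIntegralC (fun t ω => (latticeLangevinDynamics r β').noise
          (matrixConfig r.ρ (fun e' : Edge 3 L => U t ω ((fun ν => e'.1 (π.symm ν)), π e'.2))) e n i j)
          (fun t ω => W t ω (((fun ν => e.1 (π.symm ν)), π e.2), n)) (J ((fun ν => e.1 (π.symm ν)), π e.2) n i j) 𝓕 P := by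
        have eN : (fun t ω => (latticeLangevinDynamics r β').noise
            (matrixConfig r.ρ (fun e' : Edge 3 L => U t ω ((fun ν => e'.1 (π.symm ν)), π e'.2))) e n i j) =
            fun t ω => (latticeLangevinDynamics r β').noise (matrixConfig r.ρ (U t ω)) ((fun ν => e.1 (π.symm ν)), π e.2) n i j := by
          funext t ω
          rw [hQ (U t ω), noise_permute r β' _ π e n]
        rw [eN]
        exact hJ' _ n i j
      exact goal
    · filter_upwards [hae'] with ω hω
      have key : ∀ (t : ℝ≥0) (e : Edge 3 L) (i j : Fin r.N),
          r.ρ (U t ω ((fun ν => e.1 (π.symm ν)), π e.2)) i j = r.ρ (U 0 ω ((fun ν => e.1 (π.symm ν)), π e.2)) i j +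
            (∫ s in (0 : ℝ)..t, (latticeLangevinDynamics r β').drift
              (matrixConfig r.ρ (fun e' : Edge 3 L => U s.toNNReal ω ((fun ν => e'.1 (π.symm ν)), π e'.2))) e i j) +
            ∑ n : NoiseIdx r.N, J ((fun ν => e.1 (π.symm ν)), π e.2) n i j t ω := by
        intro t e i j
        have hint : (∫ s in (0 : ℝ)..t, (latticeLangevinDynamics r β').drift
            (matrixConfig r.ρ (fun e' : Edge 3 L => U s.toNNReal ω ((fun ν => e'.1 (π.symm ν)), π e'.2))) e i j) =
            ∫ s in (0 : ℝ)..t, (latticeLangevinDynamics r β').drift (matrixConfig r.ρ (U s.toNNReal ω))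
              ((fun ν => e.1 (π.symm ν)), π e.2) i j := by
          refine intervalIntegral.integral_congr fun s _ => ?_
          show (latticeLangevinDynamics r β').drift
              (matrixConfig r.ρ (fun e' : Edge 3 L => U s.toNNReal ω ((fun ν => e'.1 (π.symm ν)), π e'.2))) e i j = _
          rw [hQ (U s.toNNReal ω), drift_permute r β' _ π e]
        rw [hint]
        exact hω t _ i j
      intro t e i j
      exact key t e i j

end Transfer

/-! ## §4 Covariance in law; the cold-start law is `S₃`-invariant -/

section Law

variable {L : ℕ} [NeZero L]

/-- ★★ **`S₃` covariance in law of the SZZ dynamics**: for every start `u`, axis permutation `π`, solution `V` from `u` and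
solution `V'` from `u ∘ σ_π` (own spaces, own flat drivers): `law(V'_t) = (∘σ_π)_* law(V_t)`. [folklore] -/
theorem map_permute_eq (β' : ℝ) (π : Equiv.Perm (Fin 3)) (u : GaugeConfig 3 L (Matrix.specialUnitaryGroup (Fin 2) ℂ))
    {Ω : Type} {mΩ : MeasurableSpace Ω} {P : Measure Ω} [IsProbabilityMeasure P]
    {W : ℝ≥0 → Ω → (Edge 3 L × NoiseIdx 2 → ℝ)} (hW : IsFlatBrownian W P)
    {V : ℝ≥0 → Ω → GaugeConfig 3 L (Matrix.specialUnitaryGroup (Fin 2) ℂ)}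
    (hV0 : ∀ ω, V 0 ω = u)
    (hV : (latticeLangevinDynamics (fundamentalLatticeRep 2) β').IsSolution (fundamentalRep (Fin 2))
      hW.natFiltration P W V)
    {Ω' : Type} {mΩ' : MeasurableSpace Ω'} {P' : Measure Ω'} [IsProbabilityMeasure P']
    {W' : ℝ≥0 → Ω' → (Edge 3 L × NoiseIdx 2 → ℝ)} (hW' : IsFlatBrownian W' P')
    {V' : ℝ≥0 → Ω' → GaugeConfig 3 L (Matrix.specialUnitaryGroup (Fin 2) ℂ)}
    (hV'0 : ∀ ω, V' 0 ω = fun e : Edge 3 L => u ((fun ν => e.1 (π.symm ν)), π e.2))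
    (hV' : (latticeLangevinDynamics (fundamentalLatticeRep 2) β').IsSolution (fundamentalRep (Fin 2))
      hW'.natFiltration P' W' V') (t : ℝ≥0) :
    Measure.map (V' t) P' = (Measure.map (V t) P).map (fun x : GaugeConfig 3 L (Matrix.specialUnitaryGroup (Fin 2) ℂ) =>
      fun e : Edge 3 L => x ((fun ν => e.1 (π.symm ν)), π e.2)) := by
  have hsol := isSolution_permute β' π hV
  have hWa := isFlatBrownian_permute hW π
  have hF := natFiltration_permute_eq hW π
  have hsol' : (latticeLangevinDynamics (fundamentalLatticeRep 2) β').IsSolution (fundamentalRep (Fin 2))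
      hWa.natFiltration P (fun t ω (p : Edge 3 L × NoiseIdx 2) => W t ω (((fun ν => p.1.1 (π.symm ν)), π p.1.2), p.2))
      (fun t ω (e : Edge 3 L) => V t ω ((fun ν => e.1 (π.symm ν)), π e.2)) := by
    rw [hF]
    exact hsol
  have h2 : Measure.map (V' t) P' =
      Measure.map (fun ω => fun e : Edge 3 L => V t ω ((fun ν => e.1 (π.symm ν)), π e.2)) P :=
    lawUnique_of_start β' _ hW' hWa hV'0 hV' (fun ω => by simp only [hV0 ω]) hsol' t
  have hmV : Measurable (V t) := (hV.adapted t).mono (hW.natFiltration.le t) le_rfl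
  rw [h2, Measure.map_map (measurable_compPermute π) hmV]
  rfl

/-- ★ **The Markov semigroup commutes with axis permutations.** [folklore] -/
theorem markovTransition_permute (β' : ℝ) {Ω : Type} {mΩ : MeasurableSpace Ω} {P : Measure Ω} [IsProbabilityMeasure P]
    {W : ℝ≥0 → Ω → (Edge 3 L × NoiseIdx 2 → ℝ)} (hW : IsFlatBrownian W P)
    {U : GaugeConfig 3 L (Matrix.specialUnitaryGroup (Fin 2) ℂ) → ℝ≥0 → Ω →
      GaugeConfig 3 L (Matrix.specialUnitaryGroup (Fin 2) ℂ)}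
    (hU : ∀ x, (∀ ω, U x 0 ω = x) ∧
      (latticeLangevinDynamics (fundamentalLatticeRep 2) β').IsSolution (fundamentalRep (Fin 2))
        hW.natFiltration P W (U x))
    (π : Equiv.Perm (Fin 3)) {f : GaugeConfig 3 L (Matrix.specialUnitaryGroup (Fin 2) ℂ) → ℝ} (hf : Measurable f) (t : ℝ≥0)
    (x : GaugeConfig 3 L (Matrix.specialUnitaryGroup (Fin 2) ℂ)) :
    markovTransition U P t f (fun e : Edge 3 L => x ((fun ν => e.1 (π.symm ν)), π e.2)) =
      markovTransition U P t (f ∘ fun y : GaugeConfig 3 L (Matrix.specialUnitaryGroup (Fin 2) ℂ) =>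
        fun e : Edge 3 L => y ((fun ν => e.1 (π.symm ν)), π e.2)) x := by
  have hlaw := map_permute_eq β' π x hW (hU x).1 (hU x).2 hW
    (hU (fun e : Edge 3 L => x ((fun ν => e.1 (π.symm ν)), π e.2))).1
    (hU (fun e : Edge 3 L => x ((fun ν => e.1 (π.symm ν)), π e.2))).2 t
  have hm : ∀ y, Measurable (U y t) := fun y => ((hU y).2.adapted t).mono (hW.natFiltration.le t) le_rfl
  unfold markovTransition
  calc ∫ ω, f (U (fun e : Edge 3 L => x ((fun ν => e.1 (π.symm ν)), π e.2)) t ω) ∂P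
      = ∫ v, f v ∂(Measure.map (U (fun e : Edge 3 L => x ((fun ν => e.1 (π.symm ν)), π e.2)) t) P) :=
        (integral_map (hm _).aemeasurable hf.aestronglyMeasurable).symm
    _ = ∫ v, f v ∂((Measure.map (U x t) P).map (fun y : GaugeConfig 3 L (Matrix.specialUnitaryGroup (Fin 2) ℂ) =>
          fun e : Edge 3 L => y ((fun ν => e.1 (π.symm ν)), π e.2))) := by rw [hlaw]
    _ = ∫ v, (f ∘ fun y : GaugeConfig 3 L (Matrix.specialUnitaryGroup (Fin 2) ℂ) =>
          fun e : Edge 3 L => y ((fun ν => e.1 (π.symm ν)), π e.2)) v ∂(Measure.map (U x t) P) :=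
        integral_map (measurable_compPermute π).aemeasurable hf.aestronglyMeasurable
    _ = ∫ ω, (f ∘ fun y : GaugeConfig 3 L (Matrix.specialUnitaryGroup (Fin 2) ℂ) =>
          fun e : Edge 3 L => y ((fun ν => e.1 (π.symm ν)), π e.2)) (U x t ω) ∂P :=
        integral_map (hm _).aemeasurable (hf.comp (measurable_compPermute π)).aestronglyMeasurable

/-- ★★ **THE COLD-START LAW IS `S₃`-INVARIANT AT EVERY TIME.** [folklore] -/
theorem map_permute_coldStart (β' : ℝ) (π : Equiv.Perm (Fin 3))
    {Ω : Type} {mΩ : MeasurableSpace Ω} {P : Measure Ω} [IsProbabilityMeasure P]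
    {W : ℝ≥0 → Ω → (Edge 3 L × NoiseIdx 2 → ℝ)} (hW : IsFlatBrownian W P)
    {U : ℝ≥0 → Ω → GaugeConfig 3 L (Matrix.specialUnitaryGroup (Fin 2) ℂ)}
    (hU0 : ∀ ω, U 0 ω = fun _ => 1)
    (hU : (latticeLangevinDynamics (fundamentalLatticeRep 2) β').IsSolution (fundamentalRep (Fin 2))
      hW.natFiltration P W U) (t : ℝ≥0) :
    (Measure.map (U t) P).map (fun x : GaugeConfig 3 L (Matrix.specialUnitaryGroup (Fin 2) ℂ) =>
      fun e : Edge 3 L => x ((fun ν => e.1 (π.symm ν)), π e.2)) = Measure.map (U t) P :=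
  (map_permute_eq β' π (fun _ => 1) hW hU0 hU hW (V' := U) (fun ω => by rw [hU0 ω]) hU t).symm

/-- ★ **Cold-start expectations are `S₃`-invariant**: `E f(U_t ∘ σ_π) = E f(U_t)` for measurable `f`. [folklore] -/
theorem integral_permute_coldStart (β' : ℝ) (π : Equiv.Perm (Fin 3))
    {Ω : Type} {mΩ : MeasurableSpace Ω} {P : Measure Ω} [IsProbabilityMeasure P]
    {W : ℝ≥0 → Ω → (Edge 3 L × NoiseIdx 2 → ℝ)} (hW : IsFlatBrownian W P)
    {U : ℝ≥0 → Ω → GaugeConfig 3 L (Matrix.specialUnitaryGroup (Fin 2) ℂ)}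
    (hU0 : ∀ ω, U 0 ω = fun _ => 1)
    (hU : (latticeLangevinDynamics (fundamentalLatticeRep 2) β').IsSolution (fundamentalRep (Fin 2))
      hW.natFiltration P W U)
    {f : GaugeConfig 3 L (Matrix.specialUnitaryGroup (Fin 2) ℂ) → ℝ} (hf : Measurable f) (t : ℝ≥0) :
    ∫ ω, f (fun e : Edge 3 L => U t ω ((fun ν => e.1 (π.symm ν)), π e.2)) ∂P = ∫ ω, f (U t ω) ∂P := by
  have hmU : Measurable (U t) := (hU.adapted t).mono (hW.natFiltration.le t) le_rfl
  have hlaw := map_permute_coldStart β' π hW hU0 hU t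
  calc ∫ ω, f (fun e : Edge 3 L => U t ω ((fun ν => e.1 (π.symm ν)), π e.2)) ∂P
      = ∫ v, (f ∘ fun y : GaugeConfig 3 L (Matrix.specialUnitaryGroup (Fin 2) ℂ) =>
          fun e : Edge 3 L => y ((fun ν => e.1 (π.symm ν)), π e.2)) v ∂(Measure.map (U t) P) :=
        (integral_map hmU.aemeasurable (hf.comp (measurable_compPermute π)).aestronglyMeasurable).symm
    _ = ∫ v, f v ∂((Measure.map (U t) P).map (fun y : GaugeConfig 3 L (Matrix.specialUnitaryGroup (Fin 2) ℂ) =>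
          fun e : Edge 3 L => y ((fun ν => e.1 (π.symm ν)), π e.2))) :=
        (integral_map (measurable_compPermute π).aemeasurable hf.aestronglyMeasurable).symm
    _ = ∫ v, f v ∂(Measure.map (U t) P) := by rw [hlaw]
    _ = ∫ ω, f (U t ω) ∂P := integral_map hmU.aemeasurable hf.aestronglyMeasurable

end Law

end Summit.QuantumFields.YangMills.Theorems.ColdStartUniversality.TranslationCovariance

end
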